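import Mathlib
import HarnessLib
import Summits.KontsevichZagierPeriods.KontsevichZagierPeriods.Theorems.LinRedNormalFormResidualBeyondGenusZeroDimOneSplit
import Summits.KontsevichZagierPeriods.KontsevichZagierPeriods.Theorems.LinRedNormalFormGenusZeroValuesMzv
import Summits.KontsevichZagierPeriods.KontsevichZagierPeriods.Theorems.FermatIsogenyBetaLinearSectorGreen

/-!
# Route LinRedNormalForm, item `ResidualBeyondGenusZero` (stmt-KontsevichZagierPeriods-3917): the dimension-one split with the Green generator discharged

Line `dim-one-splice` of the declared residual `ResidualBeyondGenusZero` (RES), skeleton v3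
(`Cruxes/ResidualBeyondGenusZero/Lines/dim_one_splice.lean`): RES ⇐ DimOneKernelInKZ ∧ DimOneSeparation ∧
ResidualBeyondDimOne (glue `residualBeyondGenusZero_of_dimOnePieces`, p148287). The only move-level gap
of piece 1 in `LinRedNormalFormResidualBeyondGenusZeroDimOneSplit.lean` — the typed Green generator
`greenSet ⊆ KZ.relations` — is PROVED in the tree (`FermatIsogeny.BetaLinearSector.greenInRelations`,
unconditional: two-set adapted cylindrical decomposition, one Newton–Leibniz move per sub-band, the
engine down a band off a null set, Green = engine ×2 + swap + reflection + rule 1b). This file records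
what that buys for the split:

* `dimOneKernelInKZ_of_realOnePeriodRelations` — PIECE 1 FROM CRUX stmt-10042 ALONE: `RealOnePeriodRelations`
  (vanishing elements of `H₁` lie in `M₁ = closure (1a ∪ 1b ∪ 2 ∪ Green)`) implies Conjecture 1 (kernel
  form) on the one-dimensional sector, since `M₁ ≤ KZ.relations` unconditionally;
* `dimOneKernelInKZ_of_huberWustholzCurvePeriods` — hence piece 1 from the named fact
  `HuberWustholzCurvePeriods` (Huber–Wüstholz 2022, Thm 13.3 (2)) alone (CONDITIONAL on it);
* `dimOneSeparation_of_genusZeroValuesMzv` — PIECE 2 from Brown's theorem in the route's typing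
  (`GenusZeroValuesMzv`, item stmt-14838, itself landed conditionally on the named fact
  `GenusZeroPeriodsMZV`) and the sector's declared transcendence input (a value in the subgroup generated
  by the MZV word values which is the value of a one-dimensional combination is rational), through
  `mix_of_ratValues`;
* `residualBeyondGenusZero_of_items` / `residualBeyondGenusZero_of_namedFacts` — the whole line: RES from
  `RealOnePeriodRelations` + `GenusZeroValuesMzv` + the transcendence input + the smaller declared residual
  RES₁, resp. from the two named facts + the two declared statements.

References: M. Kontsevich, D. Zagier, *Periods* (2001), §1.2; A. Huber, G. Wüstholz, *Transcendence and
Linear Relations of 1-Periods* (2022), Thm 13.3 (2); F. Brown, Ann. ENS 42 (2009), Thm 1.1.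
-/

noncomputable section

namespace Summit.KontsevichZagierPeriods.ResidualBeyondGenusZero

open Literature.NumberTheory.Transcendental
open Summit.KontsevichZagierPeriods.KontsevichZagierPeriods.Theses.LinRedNormalForm
  (ResidualBeyondGenusZero GenusZeroValuesMzv)
open Summit.KontsevichZagierPeriods.KontsevichZagierPeriods.Theses.SymplecticScissors (RealOnePeriodRelations)
open Summit.KontsevichZagierPeriods.SymplecticScissors.RealOnePeriodRelationsNegative (greenSet H₁)
open Summit.KontsevichZagierPeriods.DihedralNormalForm.Negative (wordValueSet eval_mem_closure_wordValueSet)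

/-! ## §1 Piece 1: Conjecture 1 (kernel form) on the one-dimensional sector -/

/-- **Piece 1 of the split from crux stmt-10042 alone.** `RealOnePeriodRelations` implies that every
vanishing `ℤ`-combination of one-dimensional representations is a relation of the KZ calculus: the
typed Green generator lies in `KZ.relations` unconditionally
(`FermatIsogeny.BetaLinearSector.greenInRelations`), so `dimOne_kernel_le_relations` applies.
[cite: KontsevichZagier2001, §1.2] -/
theorem dimOneKernelInKZ_of_realOnePeriodRelations : Summit.KontsevichZagierPeriods.KontsevichZagierPeriods.Theses.SymplecticScissors.RealOnePeriodRelations → ∀ h ∈ AddSubgroup.closure (Set.range fun r : Literature.NumberTheory.Transcendental.KZ.IntegralRep 1 => Literature.NumberTheory.Transcendental.KZ.of r), Literature.NumberTheory.Transcendental.KZ.eval h = 0 → h ∈ Literature.NumberTheory.Transcendental.KZ.relations :=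
  fun h₁ => dimOne_kernel_le_relations h₁
    Summit.KontsevichZagierPeriods.FermatIsogeny.BetaLinearSector.greenInRelations

/-- **Piece 1 of the split from the named fact `HuberWustholzCurvePeriods` alone** (Huber–Wüstholz
2022, Thm 13.3 (2), through the landed `realOnePeriodRelations_of_huberWustholzCurvePeriods` of
stmt-10042 and the tree's Green lemma). CONDITIONAL on the named fact.
[cite: HuberWustholz2022, Thm 13.3 (2)] -/
theorem dimOneKernelInKZ_of_huberWustholzCurvePeriods (hHW : HuberWustholzCurvePeriods) :
    ∀ h ∈ AddSubgroup.closure (Set.range fun r : KZ.IntegralRep 1 => KZ.of r),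
      KZ.eval h = 0 → h ∈ KZ.relations :=
  dimOneKernelInKZ_of_realOnePeriodRelations
    (Summit.KontsevichZagierPeriods.SymplecticScissors.RealOnePeriodRelations.realOnePeriodRelations_of_huberWustholzCurvePeriods
      hHW)

/-! ## §2 Piece 2: separation of the one-dimensional part, from Brown's theorem and the transcendence input -/

/-- Values of the genus-zero closure lie in the subgroup generated by the MZV word values, granted
Brown's theorem in the typing of `GenusZeroValuesMzv` (closure induction; soundness transports word
representations to word values). [cite: BrownENS2009, Thm 1.1] -/
theorem eval_mem_closure_wordValueSet_of_genusZeroValuesMzv (hB : GenusZeroValuesMzv) :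
    ∀ g ∈ AddSubgroup.closure Negative.gzSet, KZ.eval g ∈ AddSubgroup.closure wordValueSet := by
  intro g hg
  induction hg using AddSubgroup.closure_induction with
  | mem x hx =>
    obtain ⟨k, r, ⟨p, a, b, c, hdom, hint⟩, rfl⟩ := hx
    obtain ⟨m, hm, hmv⟩ := hB k r p a b c hdom hint
    rw [KZ.eval_of, ← hmv]
    exact eval_mem_closure_wordValueSet hm
  | zero => simp
  | add x y _ _ hx hy => simpa using add_mem hx hy
  | neg x _ hx => simpa using neg_mem hx

/-- **The rational-shared-values hypothesis of `mix_of_ratValues`** from Brown's theorem and the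
sector's transcendence input: if `eval g + eval h = 0` for a genus-zero combination `g` and a
one-dimensional combination `h`, then `eval h = −eval g` lies in the MZV value subgroup, hence is
rational by the input, hence so is `eval g`. [folklore] -/
theorem ratValues_of_genusZeroValuesMzv (hB : GenusZeroValuesMzv)
    (hT : ∀ h ∈ H₁, KZ.eval h ∈ AddSubgroup.closure wordValueSet → ∃ q : ℚ, KZ.eval h = q) :
    ∀ g ∈ AddSubgroup.closure Negative.gzSet, ∀ h ∈ H₁,
      KZ.eval g + KZ.eval h = 0 → ∃ q : ℚ, KZ.eval g = q := by
  intro g hg h hh hgh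
  have hval : KZ.eval h = -KZ.eval g := by linarith
  have hmem : KZ.eval h ∈ AddSubgroup.closure wordValueSet := by
    rw [hval]
    exact neg_mem (eval_mem_closure_wordValueSet_of_genusZeroValuesMzv hB g hg)
  obtain ⟨q, hq⟩ := hT h hh hmem
  refine ⟨-q, ?_⟩
  rw [Rat.cast_neg, ← hq, hval, neg_neg]

/-- **Piece 2 of the split** (`DimOneSeparation`, over the named generator set `gzSet`) from Brown's
theorem in the route's typing and the transcendence input, through `mix_of_ratValues` (the shared
constant `[Δ₁, q]` is at once genus-zero and one-dimensional, so no move is needed).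
[cite: BrownENS2009, Thm 1.1] -/
theorem dimOneSeparation_of_genusZeroValuesMzv (hB : GenusZeroValuesMzv)
    (hT : ∀ h ∈ H₁, KZ.eval h ∈ AddSubgroup.closure wordValueSet → ∃ q : ℚ, KZ.eval h = q) :
    ∀ m ∈ AddSubgroup.closure (Negative.gzSet ∪ Set.range fun r : KZ.IntegralRep 1 => KZ.of r),
      KZ.eval m = 0 → ∃ g ∈ AddSubgroup.closure Negative.gzSet, ∃ h ∈ H₁,
        KZ.eval h = 0 ∧ m - g - h ∈ KZ.relations :=
  mix_of_ratValues (ratValues_of_genusZeroValuesMzv hB hT)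

/-! ## §3 The line, composed: RES from the two items and the two declared statements -/

/-- **`ResidualBeyondGenusZero` from the items `RealOnePeriodRelations` (crux stmt-10042) and
`GenusZeroValuesMzv` (stmt-14838), the declared transcendence input and the smaller declared residual
RES₁** — the line `dim-one-splice` with its Green generator discharged by the tree
(`residualBeyondGenusZero_of_dimOne_ratValues`). [folklore] -/
theorem residualBeyondGenusZero_of_items (h₁ : RealOnePeriodRelations) (h₃ : GenusZeroValuesMzv)
    (h₄ : ∀ h ∈ H₁, KZ.eval h ∈ AddSubgroup.closure wordValueSet → ∃ q : ℚ, KZ.eval h = q)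
    (h₅ : ∀ c : KZ.FormalRep, KZ.eval c = 0 →
      ∃ c₁ ∈ AddSubgroup.closure (Negative.gzSet ∪ Set.range fun r : KZ.IntegralRep 1 => KZ.of r),
        c - c₁ ∈ KZ.relations) :
    ResidualBeyondGenusZero :=
  residualBeyondGenusZero_of_dimOne_ratValues h₁
    Summit.KontsevichZagierPeriods.FermatIsogeny.BetaLinearSector.greenInRelations h₅
    (ratValues_of_genusZeroValuesMzv h₃ h₄)

/-- **`ResidualBeyondGenusZero` from the literature plus the two declared statements**: the named
facts `HuberWustholzCurvePeriods` (Huber–Wüstholz 2022, Thm 13.3 (2)) and `GenusZeroPeriodsMZV`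
(Brown 2009, Thm 1.1) discharge the two items through their landed conditional proofs
(`realOnePeriodRelations_of_huberWustholzCurvePeriods`, `genusZeroValuesMzv_proof`); what remains is the
sector's transcendence input and the residual beyond `GZ ∪ D₁` — both declared, both summit-implied.
CONDITIONAL on the two named facts. [cite: HuberWustholz2022, Thm 13.3 (2)] [cite: BrownENS2009, Thm 1.1] -/
theorem residualBeyondGenusZero_of_namedFacts (hHW : HuberWustholzCurvePeriods)
    (hBrown : GenusZeroPeriodsMZV)
    (h₄ : ∀ h ∈ H₁, KZ.eval h ∈ AddSubgroup.closure wordValueSet → ∃ q : ℚ, KZ.eval h = q)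
    (h₅ : ∀ c : KZ.FormalRep, KZ.eval c = 0 →
      ∃ c₁ ∈ AddSubgroup.closure (Negative.gzSet ∪ Set.range fun r : KZ.IntegralRep 1 => KZ.of r),
        c - c₁ ∈ KZ.relations) :
    ResidualBeyondGenusZero :=
  residualBeyondGenusZero_of_items
    (Summit.KontsevichZagierPeriods.SymplecticScissors.RealOnePeriodRelations.realOnePeriodRelations_of_huberWustholzCurvePeriods
      hHW)
    (Summit.KontsevichZagierPeriods.LinRedNormalForm.genusZeroValuesMzv_proof hBrown) h₄ h₅

end Summit.KontsevichZagierPeriods.ResidualBeyondGenusZero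

end
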